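import Summits.Ventures.CertifiedManyBodySolver.Theorems.M3x2EdgeSplitSymReplayPackedNFBridge
import Summits.Ventures.CertifiedManyBodySolver.Theorems.M3x2EdgeSplitSymReplayOracleCanonBox
import HarnessLib

/-!
# SymReplay checker — E4-on-E5: the PACKED TWIN of the executed hinted box pipe and its TRANSFER to `outOKHBZ`

(team lb-sym, cell hub-lb; engine item «E4 bridge + E5 transfer» (crit-1 V154) for the Lean-replay COST of
stmt-Ventures-22024's E-class certificate; E5 = hub-lb-sym-plan-1's ORACLE CANON landed by hub-lb-sym-eng-3 as
`…SymReplayOracleCanon` / `…SymReplayOracleCanonBox`; packed nf/collect = parts 1–2 `…SymReplayPackedNF(Bridge)`;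
this file by hub-lb-sym-eng-4 g2.  ADDITIVE: nothing landed is touched.)

WHAT.  The E5 fact slot of record is `outOKHBZ K oracle κ J lo hi i = isZero (canonNFZHBZ lo hi oracle (shareR K κ J i))`:
normal-order + collect + drop zeros, then per surviving term the VERIFIED hinted step `inBox lo hi (moveWordZ γ v u)` +
`nfWord (moveWordZ γ v u)` (+ a validated opposite-sign partner for a zero claim), then the final collect-to-zero.  Here the
same computation runs on `ℕ` letter codes END TO END after ONE encode pass of the input: (f) the packed closed-form move
`pmoveL/pmoveW` (decode `(a, b, tail)` once, `d4Z γ`, translate, four comparisons, re-encode; `none` iff the image leaves the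
box) with `pmoveW_encW : InB lo hi u → pmoveW … (encW u) = if inBox lo hi (moveWordZ γ (mkSite v0 v1) u) then some (encW …)
else none`; (g) packed hints `PHint` (point-group element + two integers + optional partner), the induced tree oracle
`oracleOfP lo hi oP w := (oP (encW lo hi w)).toHintT`, the packed partner test / term canon / pipe `ppartnerBZ`,
`pcanonTermHWBZ`, `pcanonNFZHBZ`, the per-module Boolean **`ppipeOKHBZ lo hi oP s := psuppInB lo hi s && pisZero
(pcanonNFZHBZ lo hi oP (encP lo hi s))`** (the `native_decide` target), and the proved agreement chain
`pcanonTermHWBZ_agree`, `pcanonNFZHBZ_agree`, `pisZero_pcanonNFZHBZ : PInB lo hi s → pisZero (pcanonNFZHBZ lo hi oP (encP s))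
= isZero (canonNFZHBZ lo hi (oracleOfP lo hi oP) s)`.

TRANSFER (consumed unchanged by `OutFactsHBZ` / `energyDensity_ge_of_outrouteHBZ`, ANY packed oracle `oP`):
**`isZero_canonNFZHBZ_of_packed : ppipeOKHBZ lo hi oP s = true → isZero (canonNFZHBZ lo hi (oracleOfP lo hi oP) s) = true`**
(generic in the input polynomial `s`, so a moment-bucketed share `shareRFastM …` is served the same way), its box-form twin
`isZero_canonNFZHB_of_packed`, and **`outOKHBZ_of_packed : ppipeOKHBZ lo hi oP (shareR K κ J i) = true →
outOKHBZ K (oracleOfP lo hi oP) κ J lo hi i = true`**.  Module grammar: `theorem out_i : outOKHBZ K (oracleOfP lo hi oP) κ J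
lo hi i = true := outOKHBZ_of_packed K oP κ J lo hi i (by native_decide)`.  A wrong packed oracle only makes the Boolean
false — soundness is E5's `canonTermHW_sound` for every hint; all proofs here are refinement equations (standard axioms,
no `native_decide`).

HONEST FRAMING: a checker COST lever (hub-lb-sym-ref-1 measured packed nf ×2.4 / gen+nf+collect ×6 / packed canon ×8.8–9.5
interpreted); no certificate lands by this file; no bound of record moves; no summit or crux statement is proved here;
nothing here predicts superconductivity.
-/

namespace Summit.Ventures.CertifiedManyBodySolver.Theorems.SymReplay.PackedNF

open Literature.Probability.LatticeModels (Site)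
open Summit.Ventures.CertifiedManyBodySolver.Theorems.SymReplay

/-! ## (f) Packed closed-form move (twin of `moveWordZ` on codes) -/

section Move

variable {lo hi : ℤ × ℤ}

/-- Decode a packed letter to `(a, b, tail)`: box coordinates and `tail = 2·spin + (1 − dag)`. -/
def decAB (lo hi : ℤ × ℤ) (c : ℕ) : ℤ × ℤ × ℕ :=
  let r := c / 4
  (lo.1 + ((r / boxW lo hi : ℕ) : ℤ), lo.2 + ((r % boxW lo hi : ℕ) : ℤ), c % 4)

/-- **Packed move of one code**: decode, apply the closed-form point-group map `d4Z γ`, translate by `(v0, v1)`, box-test,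
re-encode; `none` iff the image leaves the box. -/
def pmoveL (lo hi : ℤ × ℤ) (γ : DihedralGroup 4) (v0 v1 : ℤ) (c : ℕ) : Option ℕ :=
  let t := decAB lo hi c
  let p := d4Z γ t.1 t.2.1
  let a := p.1 + v0
  let b := p.2 + v1
  if (decide (lo.1 ≤ a) && decide (a ≤ hi.1) && decide (lo.2 ≤ b) && decide (b ≤ hi.2)) = true then
    some (4 * ((a - lo.1).toNat * boxW lo hi + (b - lo.2).toNat) + t.2.2)
  else none

/-- **Packed move of a word** (`none` iff some letter leaves the box; letter order kept). -/
def pmoveW (lo hi : ℤ × ℤ) (γ : DihedralGroup 4) (v0 v1 : ℤ) : PWord → Option PWord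
  | [] => some []
  | c :: w =>
    match pmoveL lo hi γ v0 v1 c with
    | none => none
    | some c' =>
      match pmoveW lo hi γ v0 v1 w with
      | none => none
      | some w' => some (c' :: w')

/-- The tail digit `2·spin + (1 − dag)` of a letter. -/
def tailL (ℓ : Letter) : ℕ := 2 * ℓ.s.val + (if ℓ.dag then 0 else 1)

/-- The tail digit is below `4`. -/
theorem tailL_lt (ℓ : Letter) : tailL ℓ < 4 := by
  unfold tailL; have := ℓ.s.isLt; split <;> omega

/-- `encL = 4·rank + tail`. -/
theorem encL_eq_rank_tail (ℓ : Letter) : encL lo hi ℓ = 4 * siteRank lo hi ℓ.x + tailL ℓ := by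
  unfold encL tailL; ring

/-- Decoding a box letter's code returns its coordinates and tail. -/
theorem decAB_encL {ℓ : Letter} (hℓ : inBoxSite lo hi ℓ.x = true) :
    decAB lo hi (encL lo hi ℓ) = (ℓ.x 0, ℓ.x 1, tailL ℓ) := by
  have ht := tailL_lt ℓ
  have hdiv : encL lo hi ℓ / 4 = siteRank lo hi ℓ.x := by rw [encL_eq_rank_tail]; omega
  have hmod : encL lo hi ℓ % 4 = tailL ℓ := by rw [encL_eq_rank_tail]; omega
  have hW : 0 < boxW lo hi := lt_of_le_of_lt (Nat.zero_le _) (colDigit_lt hℓ)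
  have hq : siteRank lo hi ℓ.x / boxW lo hi = (ℓ.x 0 - lo.1).toNat := by
    unfold siteRank
    rw [add_comm, Nat.add_mul_div_right _ _ hW, Nat.div_eq_of_lt (colDigit_lt hℓ), zero_add]
  have hr : siteRank lo hi ℓ.x % boxW lo hi = (ℓ.x 1 - lo.2).toNat := by
    unfold siteRank
    rw [add_comm, Nat.add_mul_mod_self_right, Nat.mod_eq_of_lt (colDigit_lt hℓ)]
  rw [inBoxSite_iff] at hℓ
  unfold decAB
  simp only [hdiv, hmod, hq, hr]
  refine Prod.ext ?_ (Prod.ext ?_ rfl) <;> simp only <;> omega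

/-- The moved letter of the executed form `moveWordZ`. -/
def movedL (γ : DihedralGroup 4) (v0 v1 : ℤ) (ℓ : Letter) : Letter :=
  let p := d4Z γ (ℓ.x 0) (ℓ.x 1); ⟨mkSite (p.1 + v0) (p.2 + v1), ℓ.s, ℓ.dag⟩

/-- First coordinate of a moved letter. -/
theorem movedL_x0 (γ : DihedralGroup 4) (v0 v1 : ℤ) (ℓ : Letter) :
    (movedL γ v0 v1 ℓ).x 0 = (d4Z γ (ℓ.x 0) (ℓ.x 1)).1 + v0 := rfl
/-- Second coordinate of a moved letter. -/
theorem movedL_x1 (γ : DihedralGroup 4) (v0 v1 : ℤ) (ℓ : Letter) :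
    (movedL γ v0 v1 ℓ).x 1 = (d4Z γ (ℓ.x 0) (ℓ.x 1)).2 + v1 := rfl
/-- A move keeps spin and dagger, hence the tail digit. -/
theorem tailL_movedL (γ : DihedralGroup 4) (v0 v1 : ℤ) (ℓ : Letter) : tailL (movedL γ v0 v1 ℓ) = tailL ℓ := rfl

/-- `moveWordZ` is the letterwise `movedL`. -/
theorem moveWordZ_eq_map (γ : DihedralGroup 4) (v0 v1 : ℤ) (w : Word) :
    moveWordZ γ (mkSite v0 v1) w = w.map (movedL γ v0 v1) := rfl

/-- **Packed move of a box letter's code** = box test + code of the moved letter. -/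
theorem pmoveL_encL (γ : DihedralGroup 4) (v0 v1 : ℤ) {ℓ : Letter} (hℓ : inBoxSite lo hi ℓ.x = true) :
    pmoveL lo hi γ v0 v1 (encL lo hi ℓ) =
      if inBoxSite lo hi (movedL γ v0 v1 ℓ).x = true then some (encL lo hi (movedL γ v0 v1 ℓ)) else none := by
  unfold pmoveL
  simp only [decAB_encL hℓ]
  simp only [inBoxSite, movedL_x0, movedL_x1, tailL_movedL, encL_eq_rank_tail, siteRank]
  rfl

/-- **Packed move of a box word's code** = box test + code of the moved word. -/
theorem pmoveW_encW (γ : DihedralGroup 4) (v0 v1 : ℤ) :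
    ∀ (u : Word), InB lo hi u → pmoveW lo hi γ v0 v1 (encW lo hi u) =
      if inBox lo hi (moveWordZ γ (mkSite v0 v1) u) = true then some (encW lo hi (moveWordZ γ (mkSite v0 v1) u)) else none
  | [], _ => by simp [pmoveW, moveWordZ_eq_map, inBox_eq_all]
  | ℓ :: u, hu => by
    have hℓ := (InB.cons_iff.1 hu).1
    have ih := pmoveW_encW γ v0 v1 u (InB.cons_iff.1 hu).2
    rw [moveWordZ_eq_map] at ih ⊢
    simp only [encW_cons, pmoveW, pmoveL_encL γ v0 v1 hℓ, ih, List.map_cons, inBox_eq_all, List.all_cons]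
    rcases Bool.eq_false_or_eq_true (inBoxSite lo hi (movedL γ v0 v1 ℓ).x) with h1 | h1 <;>
      rcases Bool.eq_false_or_eq_true ((u.map (movedL γ v0 v1)).all fun m => inBoxSite lo hi m.x) with h2 | h2 <;>
        simp [h1, h2]

end Move

/-! ## (g) Packed hints and the packed twin of the EXECUTED hinted box canon `canonTermHWBZ / canonNFZHBZ` -/

section Hinted

variable {lo hi : ℤ × ℤ}

/-- A hint in first-order data: point-group element, translation `(v0, v1)`, optional partner likewise. -/
structure PHint where
  /-- the point-group element of the chosen image -/
  γ : DihedralGroup 4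
  /-- translation, first coordinate -/
  v0 : ℤ
  /-- translation, second coordinate -/
  v1 : ℤ
  /-- the partner move of a zero claim, if any -/
  partner : Option (DihedralGroup 4 × ℤ × ℤ)

/-- The tree hint named by a packed hint. -/
def PHint.toHintT (h : PHint) : HintT :=
  ⟨h.γ, mkSite h.v0 h.v1, h.partner.map fun p => (p.1, mkSite p.2.1 p.2.2)⟩

/-- **The tree oracle induced by a packed oracle** (the `oracle` slot of `outOKHBZ` / `energyDensity_ge_of_outrouteHBZ`). -/
def oracleOfP (lo hi : ℤ × ℤ) (oP : PWord → PHint) : Word → HintT := fun w => (oP (encW lo hi w)).toHintT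

/-- `c = −best` syntactically on packed polynomials (verbatim twin of `polyNegEq`). -/
def ppolyNegEq : PPoly → PPoly → Bool
  | [], [] => true
  | t :: p, t' :: q => pwordEq t.2 t'.2 && decide (t'.1 = -t.1) && ppolyNegEq p q
  | _, _ => false

/-- Packed validated-partner TEST (twin of `(partnerOfBZ lo hi h u).isSome`, given the image `img` of the main move). -/
def ppartnerBZ (lo hi : ℤ × ℤ) (h : PHint) (u : PWord) (img : PPoly) : Bool :=
  match h.partner with
  | none => false
  | some p =>
    match pmoveW lo hi p.1 p.2.1 p.2.2 u with
    | none => false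
    | some w' => ppolyNegEq img (pnfWord w')

/-- **Packed hinted term canon** (twin of `canonTermHWBZ lo hi h.toHintT`). -/
def pcanonTermHWBZ (lo hi : ℤ × ℤ) (h : PHint) (t : ℚ × PWord) : PPoly :=
  match pmoveW lo hi h.γ h.v0 h.v1 t.2 with
  | none => [t]
  | some w => if ppartnerBZ lo hi h t.2 (pnfWord w) then [] else ppscale t.1 (pnfWord w)

/-- **Packed hinted zero-filtered pipe** (twin of `canonNFZHBZ lo hi (oracleOfP lo hi oP)` on coded input). -/
def pcanonNFZHBZ (lo hi : ℤ × ℤ) (oP : PWord → PHint) (p : PPoly) : PPoly :=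
  (pdropZeros (pcollect2 (pnfPoly p))).flatMap fun t => pcanonTermHWBZ lo hi (oP t.2) t

/-- **The packed per-module Boolean**: input in the box, and the packed pipe of its code collects to zero
(the `native_decide` target; transfer lemma `isZero_canonNFZHBZ_of_packed`). -/
def ppipeOKHBZ (lo hi : ℤ × ℤ) (oP : PWord → PHint) (s : QPoly) : Bool :=
  psuppInB lo hi s && pisZero (pcanonNFZHBZ lo hi oP (encP lo hi s))

/-- `polyNegEq` agreement. -/
theorem ppolyNegEq_agree : ∀ (p q : QPoly), PInB lo hi p → PInB lo hi q →
    ppolyNegEq (encP lo hi p) (encP lo hi q) = polyNegEq p q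
  | [], [], _, _ => rfl
  | [], _ :: _, _, _ => rfl
  | _ :: _, [], _, _ => rfl
  | t :: p, t' :: q, hp, hq => by
    simp only [encP_cons, ppolyNegEq, polyNegEq, pwordEq_agree t.2 t'.2 (PInB.cons_iff.1 hp).1 (PInB.cons_iff.1 hq).1,
      ppolyNegEq_agree p q (PInB.cons_iff.1 hp).2 (PInB.cons_iff.1 hq).2]

/-- A moved word that passed the box test is in the box. -/
theorem InB.of_inBox {w : Word} (h : inBox lo hi w = true) : InB lo hi w := (inBox_iff w).1 h

/-- **Packed hinted term canon agreement**: on a box term the packed canon is the code of the tree's executed canon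
under the induced hint. -/
theorem pcanonTermHWBZ_agree (h : PHint) (t : ℚ × Word) (ht : InB lo hi t.2) :
    pcanonTermHWBZ lo hi h (t.1, encW lo hi t.2) = encP lo hi (canonTermHWBZ lo hi h.toHintT t) := by
  unfold pcanonTermHWBZ canonTermHWBZ ppartnerBZ partnerOfBZ PHint.toHintT
  simp only [pmoveW_encW h.γ h.v0 h.v1 t.2 ht]
  rcases Bool.eq_false_or_eq_true (inBox lo hi (moveWordZ h.γ (mkSite h.v0 h.v1) t.2)) with hb | hb
  · have hmv : InB lo hi (moveWordZ h.γ (mkSite h.v0 h.v1) t.2) := InB.of_inBox hb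
    rcases hp : h.partner with _ | ⟨γ', a', b'⟩
    · simp [hb, pnfWord_agree _ hmv, ppscale_encP]
    · simp only [Option.map_some, pmoveW_encW γ' a' b' t.2 ht]
      rcases Bool.eq_false_or_eq_true (inBox lo hi (moveWordZ γ' (mkSite a' b') t.2)) with hb' | hb'
      · have hmv' : InB lo hi (moveWordZ γ' (mkSite a' b') t.2) := InB.of_inBox hb'
        have hneg := ppolyNegEq_agree _ _ (PInB.nfWord (lo := lo) (hi := hi) hmv) (PInB.nfWord hmv')
        rcases Bool.eq_false_or_eq_true (polyNegEq (nfWord (moveWordZ h.γ (mkSite h.v0 h.v1) t.2))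
            (nfWord (moveWordZ γ' (mkSite a' b') t.2))) with hn | hn
        · simp [hb, hb', hn, pnfWord_agree _ hmv, pnfWord_agree _ hmv', hneg]
        · simp [hb, hb', hn, pnfWord_agree _ hmv, pnfWord_agree _ hmv', hneg, ppscale_encP]
      · simp [hb, hb', pnfWord_agree _ hmv, ppscale_encP]
  · simp [hb]

/-- The tree's executed term canon keeps box terms in the box (any hint). -/
theorem PInB.canonTermHWBZ (h : HintT) (t : ℚ × Word) (ht : InB lo hi t.2) : PInB lo hi (canonTermHWBZ lo hi h t) := by
  unfold SymReplay.canonTermHWBZ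
  rcases Bool.eq_false_or_eq_true (inBox lo hi (moveWordZ h.γ h.v t.2)) with hb | hb
  · simp only [hb, if_true]
    rcases partnerOfBZ lo hi h t.2 with _ | _
    · exact (PInB.nfWord (InB.of_inBox hb)).pscale
    · exact PInB.nil
  · simp only [hb, Bool.false_eq_true, if_false]
    exact PInB.cons_iff.2 ⟨ht, PInB.nil⟩

/-- The tree's executed hinted pipe keeps box input in the box (any oracle). -/
theorem PInB.canonNFZHBZ (oracle : Word → HintT) {s : QPoly} (hs : PInB lo hi s) :
    PInB lo hi (canonNFZHBZ lo hi oracle s) := by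
  intro t ht
  unfold SymReplay.canonNFZHBZ at ht
  rw [List.mem_flatMap] at ht
  obtain ⟨t0, ht0, ht⟩ := ht
  exact PInB.canonTermHWBZ (oracle t0.2) t0 (hs.nfPoly.collect.dropZeros t0 ht0) t ht

/-- **Packed hinted pipe agreement**: on box input the packed pipe of the code is the code of the tree's executed pipe
under the induced oracle. -/
theorem pcanonNFZHBZ_agree (oP : PWord → PHint) {s : QPoly} (hs : PInB lo hi s) :
    pcanonNFZHBZ lo hi oP (encP lo hi s) = encP lo hi (canonNFZHBZ lo hi (oracleOfP lo hi oP) s) := by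
  unfold pcanonNFZHBZ canonNFZHBZ
  rw [pnfPoly_agree s hs, pcollect2_agree _ hs.nfPoly, pdropZeros_agree]
  conv_lhs => rw [encP, flatMap_map_left]
  conv_rhs => rw [encP, map_flatMap']
  refine List.flatMap_congr fun t ht => ?_
  exact pcanonTermHWBZ_agree (oP (encW lo hi t.2)) t (hs.nfPoly.collect.dropZeros t ht)

/-- **The packed zero test IS the tree's zero test** (box input, induced oracle). -/
theorem pisZero_pcanonNFZHBZ (oP : PWord → PHint) {s : QPoly} (hs : PInB lo hi s) :
    pisZero (pcanonNFZHBZ lo hi oP (encP lo hi s)) = isZero (canonNFZHBZ lo hi (oracleOfP lo hi oP) s) := by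
  rw [pcanonNFZHBZ_agree oP hs, pisZero_encP _ (PInB.canonNFZHBZ _ hs)]

/-- **TRANSFER**: the packed per-module Boolean implies the tree's executed hinted pipe collects to zero. -/
theorem isZero_canonNFZHBZ_of_packed (lo hi : ℤ × ℤ) (oP : PWord → PHint) (s : QPoly)
    (h : ppipeOKHBZ lo hi oP s = true) : isZero (canonNFZHBZ lo hi (oracleOfP lo hi oP) s) = true := by
  unfold ppipeOKHBZ at h
  rw [Bool.and_eq_true] at h
  rw [← pisZero_pcanonNFZHBZ oP ((psuppInB_iff s).1 h.1)]
  exact h.2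

/-- The same for the box form `canonNFZHB` (`canonNFZHBZ_eq`). -/
theorem isZero_canonNFZHB_of_packed (lo hi : ℤ × ℤ) (oP : PWord → PHint) (s : QPoly)
    (h : ppipeOKHBZ lo hi oP s = true) : isZero (canonNFZHB lo hi (oracleOfP lo hi oP) s) = true := by
  rw [← canonNFZHBZ_eq]; exact isZero_canonNFZHBZ_of_packed lo hi oP s h

/-- **THE FACT SLOT OF RECORD**: a packed module fact on the share `shareR K κ J i` gives `outOKHBZ … i = true` for the
induced oracle — consumed unchanged by `OutFactsHBZ` / `energyDensity_ge_of_outrouteHBZ`. -/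
theorem outOKHBZ_of_packed (K : SymCertR) (oP : PWord → PHint) (κ : Word → ℕ) (J : ℕ) (lo hi : ℤ × ℤ) (i : ℕ)
    (h : ppipeOKHBZ lo hi oP (shareR K κ J i) = true) : outOKHBZ K (oracleOfP lo hi oP) κ J lo hi i = true := by
  unfold outOKHBZ
  exact isZero_canonNFZHBZ_of_packed lo hi oP _ h

end Hinted

end Summit.Ventures.CertifiedManyBodySolver.Theorems.SymReplay.PackedNF
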